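import Literature.AnabelianGeometry.EtaleTheta.Discharge.Sec5Thm57GenuineBindersA

/-!
# [EtTh] §5, Theorem 5.7 at ALL levels from a CONSTANT-ANCHORED family: the per-anchor binders of the anchored capstone restricted to
# normalised anchors whose discrepancy unit is a NAMED CONSTANT (pp. 318–319, 329–331 / PDF pp. 92–93, 103–105)

Mochizuki, *The étale theta function …*, Publ. RIMS **45** (2009)
[cite: MochizukiEtTh2009, Thm 5.7 p.330 (PDF p.104); Rmk 4.3.2 p.318–319 (PDF pp.92–93); Lem 5.8 p.331 (PDF p.105);
Def 3.6 (iii) p.303 (PDF p.77)].  abc-iut cell, layer L2, node `EtTh:Thm5.7`; abc-iut-L2-lead (gen 5) R690/R719 «HCFIX@PRODUCED-ANCHOR»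
= GO (seat abc-iut-f-123 gen 6).  PROOF-ONLY twin (0 definitions, 0 new named facts; nothing landed is edited or restated) of
abc-iut-L2-d4's `Discharge/Sec5Thm57AnchoredFamily.lean` (p442166, `…_ofAnchored_ofPulledConstants`) and of abc-iut-w5-d123's re-keyings
in `Discharge/Sec5Thm57GenuineBindersA.lean` (p447915, `…_genuine`, `…_genuine_of_constantsDictionary`).

THE POINT.  In the anchored capstone the coherent family `hfam` — and through it, in the final knits v1–v4, every PER-ANCHOR root
binder (`hroot₁N` / `hsurj`, `hcfix`, `hivP′` / `hivPiso`) — is quantified over EVERY normalised anchor `(α₁, β₁, u₁)`, `u₁ ∈ O^×(B_1)`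
an arbitrary unit.  But the chain consumes `hfam` at EXACTLY ONE anchor: the anchor PRODUCED at the first root by abc-iut-w5-d245's
`ThetaFrobenioid.exists_unit_transports_hYdd_ofConnectedTemperoidData_strv` (p437125), normalised as `(αs ≪≫ e₁, βs ≪≫ (D_c¹)⁻¹, D_p¹)`.
For THAT anchor the discrepancy unit `u₁ = D_p¹` IS A CONSTANT: abc-iut-L2-t4's `ThetaFrobenioid.discrepancy_mem_OKxRootN`
(`Sec5Thm57Constants`) at the level-`1` datum — from the level-1 §5 facts (`SgpCapSpec`, `SgpCupSpec`, Prop. 4.3 (iii), Lemma 5.8 by name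
`ConstantsActByCyclotome`), the factorisation `hfac₁`, `Ψ^Aut(O^×(B_1)) = O^×(B_1)`, and the anchor's own transport data
(`θ`, `StrvTransport`, `H_B`-stability), ALL of which the composer already holds — puts `u₁` in `(O_K^×)^{1/N₁}` with `N₁ = 1`
(`atLevel_N`), i.e. `u₁ = c ∈ K^×` (`exists_const_of_mem_OKxRootN_of_N_eq_one`): `exists_const_of_normalisedAnchor` (generic tower).
Hence the capstone holds with `hfam` asked ONLY for normalised anchors CARRYING A CONSTANT WITNESS
`(c : K^×) (hcst : unitsToBirat u₁ = constEmb 1 c)`: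
* `thetaRootPreservedAll_ofConnectedTemperoidYddFamily_ofConstAnchored_ofPulledConstants` (twin of p442166; proof verbatim except that
  the constant is produced before the family is chosen);
* `…_ofConstAnchored_ofPulledConstants_genuine`, `…_ofConstAnchored_genuine_of_constantsDictionary` (twins of p447915's re-keyings:
  `hN` gone, `hinj` ⟸ {`hc₀`, `ht`}, `hfac₁` ⟸ {`hP34`, `ecn`, `hYdd`}, `hgc₁` ⟸ `ConstantsDictionary` + `hY₁`).
Downstream (`…FinalKnitV5`): at a constant anchor the per-anchor clauses are THEOREMS or print-verbatim — `hcfix` by Def. 3.6 (iii) for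
base-curve constants (abc-iut-f-123 p455663 `isFixedByHA_pullFrac_pullFrac_unit_of_unit_eq`), `hsurj` by Lemma 5.8 for constants
«`(K^×)^{1/N} ⊆ O^×(B_N^birat)`».
HONEST FRAMING: kernel-checked implications under named hypotheses for data so parametrised (the class
`TemperedFrobenioid T₀ (ConnectedPart (BTemp X.Pi)) VD` is not shown inhabited for an actual curve); nothing asserts any result of [EtTh]
unconditionally; typed ≠ discharged; no side taken on anything downstream ([IUTchIII] Cor. 3.12 in particular). -/

noncomputable section

namespace Literature.AnabelianGeometry.EtaleTheta

open CategoryTheory Opposite Literature.AlgebraicGeometry.Frobenioids Literature.AnabelianGeometry.SemiGraphs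
  Literature.AnabelianGeometry.SemiGraphs.GaloisObjects

universe u₀ v₀ w v v' u u' u₁ v₁

namespace ThetaFrobenioidTower

/-! ## §1. Generic tower: the discrepancy unit of a normalised anchor at the first root is a constant -/

section Generic

variable {C : Type u} [Category.{v} C] {D : Type u'} [Category.{v'} D] (𝔗 : ThetaFrobenioidTower.{w} C D)
  (Ψ : C ≌ C)

/-- **The discrepancy unit of a NORMALISED anchor at the first root is a constant of `K`.**  For a normalised transport datum
`(α₁, β₁, u₁)` at level `1` — `α₁⁻¹ ≫ Ψ(s^⊓_1) ≫ β₁ = s^⊓_1`, `α₁⁻¹ ≫ Ψ(s^⊔_1) ≫ β₁ = s^⊔_1 ≫ u₁`, `u₁ ∈ O^×(B_1)` — with its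
Thm. 4.4 (iv)/Prop. 2.4 data (`θ₁`, `hstrv₁`, `hYdd₁`), `Ψ^Aut(O^×(B_1)) = O^×(B_1)` (`hU₁`), the level-1 §5 facts and the factorisation
`hfac₁`: `u₁ = c` for some `c ∈ K^×` (as birational units).  This is abc-iut-L2-t4's `discrepancy_mem_OKxRootN` (Thm. 5.7's rigidity
clause, `(O_K^×)^{1/N}` half, Lemma 5.8) read at `N₁ = 1`, exactly as inside `hζ₁_of_constTorsion` — but WITHOUT the torsion residual `hc`.
[cite: MochizukiEtTh2009, Thm 5.7 p.330 (PDF p.104); Lem 5.8 p.331 (PDF p.105)] -/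
theorem exists_const_of_normalisedAnchor (hepi : ∀ ⦃X Y : C⦄ (f : X ⟶ Y), Epi f)
    (hcap₁ : (𝔗.atLevel 1).SgpCapSpec) (hcup₁ : (𝔗.atLevel 1).SgpCupSpec)
    (hdiff₁ : (𝔗.atLevel 1).BiKummerDifferenceMem) (h58₁ : (𝔗.atLevel 1).ConstantsActByCyclotome)
    (hfac₁ : ∀ y ∈ (𝔗.atLevel 1).imPiY, ∃ h ∈ (𝔗.atLevel 1).HB, ∀ u ∈ (𝔗.atLevel 1).units (𝔗.BN 1),
      𝔗.sgpCap 1 y * u * (𝔗.sgpCap 1 y)⁻¹ = 𝔗.sgpCap 1 h * u * (𝔗.sgpCap 1 h)⁻¹)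
    {α₁ : Ψ.functor.obj (𝔗.AN 1) ≅ 𝔗.AN 1} {β₁ : Ψ.functor.obj (𝔗.BN 1) ≅ 𝔗.BN 1} {u₁ : Aut (𝔗.BN 1)}
    (hT₁ : α₁.inv ≫ Ψ.functor.map (𝔗.sCap 1) ≫ β₁.hom = 𝔗.sCap 1)
    (hT₁' : α₁.inv ≫ Ψ.functor.map (𝔗.sCup 1) ≫ β₁.hom = 𝔗.sCup 1 ≫ u₁.hom)
    (hu₁ : u₁ ∈ (𝔗.atLevel 1).units (𝔗.BN 1))
    (hU₁ : ((𝔗.atLevel 1).units (𝔗.BN 1)).map ((𝔗.atLevel 1).psiAut Ψ β₁) = (𝔗.atLevel 1).units (𝔗.BN 1))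
    (θ₁ : Aut (𝔗.pre.base.obj (𝔗.BN 1)) ≃* Aut (𝔗.pre.base.obj (𝔗.BN 1)))
    (hstrv₁ : (𝔗.atLevel 1).StrvTransport Ψ α₁ (Iso.refl _) θ₁)
    (hYdd₁ : (𝔗.atLevel 1).HB.map θ₁.toMonoidHom = (𝔗.atLevel 1).HB) :
    ∃ c : 𝔗.Kˣ, (𝔗.atLevel 1).unitsToBirat (𝔗.BN 1) ⟨u₁, hu₁⟩ = 𝔗.constEmb 1 c := by
  -- the anchor in `RootTransportWith` shape: `e₁ := id`, `D_c¹ := 1`, `D_p¹ := u₁`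
  have hu₁' : (1 : Aut (𝔗.BN 1))⁻¹ * u₁ ∈ (𝔗.atLevel 1).units (𝔗.BN 1) := by
    rw [inv_one, one_mul]; exact hu₁
  have hT₁r : α₁.inv ≫ Ψ.functor.map (𝔗.sCap 1) ≫ β₁.hom =
      (Iso.refl (𝔗.AN 1)).hom ≫ 𝔗.sCap 1 ≫ (1 : Aut (𝔗.BN 1)).hom := by
    rw [hT₁, Iso.refl_hom, Category.id_comp]
    show 𝔗.sCap 1 = 𝔗.sCap 1 ≫ (Iso.refl (𝔗.BN 1)).hom
    rw [Iso.refl_hom, Category.comp_id]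
  have hT₁r' : α₁.inv ≫ Ψ.functor.map (𝔗.sCup 1) ≫ β₁.hom =
      (Iso.refl (𝔗.AN 1)).hom ≫ 𝔗.sCup 1 ≫ u₁.hom := by
    rw [hT₁', Iso.refl_hom, Category.id_comp]
  haveI := hepi (𝔗.sCap 1)
  haveI := hepi (𝔗.sCup 1)
  have hO := ThetaFrobenioid.discrepancy_mem_OKxRootN (𝔉 := 𝔗.atLevel 1) Ψ α₁ β₁ (Iso.refl _) 1 u₁ θ₁ hcap₁ hcup₁ hdiff₁
    h58₁ hfac₁ hU₁ hT₁r hT₁r' hstrv₁ hYdd₁ hu₁'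
  obtain ⟨c, hc'⟩ :=
    ThetaFrobenioid.exists_const_of_mem_OKxRootN_of_N_eq_one (𝔉 := 𝔗.atLevel 1) PNat.one_coe hu₁' hO
  have heq : (⟨(1 : Aut (𝔗.BN 1))⁻¹ * u₁, hu₁'⟩ : (𝔗.atLevel 1).units (𝔗.BN 1)) = ⟨u₁, hu₁⟩ :=
    Subtype.ext (show (1 : Aut (𝔗.BN 1))⁻¹ * u₁ = u₁ by rw [inv_one, one_mul])
  refine ⟨c, ?_⟩
  rw [← heq]
  exact hc'

end Generic

/-! ## §2. The genuine connected tower: the anchored capstone with a CONSTANT-ANCHORED family (twin of p442166) -/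

section Genuine

variable {K : Type u₀} [Field K] {X : SemiGraphs.TemperedArithmeticGroup.{u₀} K} {D₀ : Type u₀} [Category.{v₀} D₀]
  {V : FrdIMonoidStub.{w}} {T₀ : RealifiedDivisorMonoids (D₀ := D₀) V}
  {VD : FrdICatStub.{u₀ + 1, u₀, w} (ConnectedPart (BTemp X.Pi))}
  {tf : TemperedFrobenioid T₀ (ConnectedPart (BTemp X.Pi)) VD} {hZ : tf.monoidType = MonoidType.Z}
  {hP : ∀ A : (ConnectedPart (BTemp X.Pi))ᵒᵖ, IsPerfect (tf.Φ.carrier A)}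
  {NH : Subgroup (Field.absoluteGaloisGroup K) → tf.category → ℕ+ → Prop}
  {E : Set ℕ+} (𝒯 : ThetaEnvTower.{max u₀ w} E) (ιX : 𝒯.PiX ≃ₜ* X.Pi)
  {pullFrac : ∀ {A A' : (BiKummerSetting.mkOfConnectedTemperoidYddTower X tf hZ hP NH 𝒯 ιX).C} (_ : A' ⟶ A),
    (BiKummerSetting.mkOfConnectedTemperoidYddTower X tf hZ hP NH 𝒯 ιX).biratUnits A →
      (BiKummerSetting.mkOfConnectedTemperoidYddTower X tf hZ hP NH 𝒯 ιX).biratUnits A'}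
  {lv : ℕ+}
  {θ : (BiKummerSetting.mkOfConnectedTemperoidYddTower X tf hZ hP NH 𝒯 ιX).biratUnits
    (BiKummerSetting.mkOfConnectedTemperoidYddTower X tf hZ hP NH 𝒯 ιX).Aodot}
  {Bl : (BiKummerSetting.mkOfConnectedTemperoidYddTower X tf hZ hP NH 𝒯 ιX).C}
  {Pl : (BiKummerSetting.mkOfConnectedTemperoidYddTower X tf hZ hP NH 𝒯 ιX).FractionPair θ Bl}
  {Rl : (BiKummerSetting.mkOfConnectedTemperoidYddTower X tf hZ hP NH 𝒯 ιX).NthRoot θ Pl lv pullFrac}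
  (h : ModelFrobenioid.Hypotheses tf.divisorMonoid tf.ratFnFunctor)
  (Q : FrobenioidTheta.ThetaSubquotientStub.{w} (ConnectedPart (BTemp X.Pi))) (odd_l : Odd (lv : ℕ))
  (R : ∀ N : ℕ+, (BiKummerSetting.mkOfConnectedTemperoidYddTower X tf hZ hP NH 𝒯 ιX).NthRoot Rl.root Rl.pair N pullFrac)
  (K' : Type w) [Field K'] {X₀ : ConnectedPart (BTemp X.Pi)}
  (hX₀ : ∀ Y : ConnectedPart (BTemp X.Pi), Subsingleton (Y ⟶ X₀)) (t : ∀ N : ℕ+, (R N).BN.base ⟶ X₀)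
  (c₀ : K'ˣ →* (tf.ratFnFunctor.obj (op X₀))ˣ)
  (hinj : ∀ N : ℕ+, Function.Injective ((Units.map (tf.ratFnFunctor.map (t N).op).hom).comp c₀))
  (hinvc : ∀ (N : ℕ+) (g : Aut (R N).AN.base),
    pull tf.divisorMonoid g.hom (ModelFrobenioid.div (R N).pair.num) = ModelFrobenioid.div (R N).pair.num)
  (hinvp : ∀ (N : ℕ+) (y : 𝒯.PiX), y ∈ 𝒯.PiYdd →
    pull tf.divisorMonoid ((BiKummerSetting.mkOfConnectedTemperoidYddTower X tf hZ hP NH 𝒯 ιX).galoisSurj (R N).AN.base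
      (R N).αData.isGalois (ιX y)).hom (ModelFrobenioid.div (R N).pair.den) = ModelFrobenioid.div (R N).pair.den)
  (α : ∀ {N N' : ℕ+}, (N : ℕ) ∣ N' → ((R N').AN ⟶ (R N).AN))
  (β : ∀ {N N' : ℕ+}, (N : ℕ) ∣ N' → ((R N').BN ⟶ (R N).BN))
  (comm_sCap : ∀ {N N' : ℕ+} (hd : (N : ℕ) ∣ N'), (R N').pair.num ≫ β hd = α hd ≫ (R N).pair.num)
  (comm_sCup : ∀ {N N' : ℕ+} (hd : (N : ℕ) ∣ N'), (R N').pair.den ≫ β hd = α hd ≫ (R N).pair.den)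
  (isIsometry_α : ∀ {N N' : ℕ+} (hd : (N : ℕ) ∣ N'),
    ((BiKummerSetting.mkOfConnectedTemperoidYddTower X tf hZ hP NH 𝒯 ιX).sec5Stub h).pre.IsIsometry (α hd))
  (degFr_α : ∀ {N N' : ℕ+} (hd : (N : ℕ) ∣ N'),
    (((BiKummerSetting.mkOfConnectedTemperoidYddTower X tf hZ hP NH 𝒯 ιX).sec5Stub h).pre.degFr (α hd) : ℕ) * N = N')
  (isIsometry_β : ∀ {N N' : ℕ+} (hd : (N : ℕ) ∣ N'),
    ((BiKummerSetting.mkOfConnectedTemperoidYddTower X tf hZ hP NH 𝒯 ιX).sec5Stub h).pre.IsIsometry (β hd))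
  (degFr_β : ∀ {N N' : ℕ+} (hd : (N : ℕ) ∣ N'),
    (((BiKummerSetting.mkOfConnectedTemperoidYddTower X tf hZ hP NH 𝒯 ιX).sec5Stub h).pre.degFr (β hd) : ℕ) * N = N')
  (baseFrob_α : ∀ {N N' : ℕ+} (hd : (N : ℕ) ∣ N'),
    (BiKummerSetting.mkOfConnectedTemperoidYddTower X tf hZ hP NH 𝒯 ιX).IsOfBaseFrobeniusType (α hd))


include hX₀ h in
/-- **[EtTh] Theorem 5.7 (root level) at ALL levels for the genuine connected tower with pulled-back constants, CONSTANT-ANCHORED form** (twin of abc-iut-L2-d4's `…_ofAnchored_ofPulledConstants`, p442166, with the coherent family `hfam` asked only for normalised anchors whose discrepancy unit is a NAMED CONSTANT `c ∈ K^×` — legitimate because the one anchor the proof consumes, PRODUCED at the first root, has a constant discrepancy unit: `exists_const_of_normalisedAnchor`; original docstring follows):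
the anchor at the first root is PRODUCED — abc-iut-w5-d245's `exists_unit_transports_hYdd_ofConnectedTemperoidData_strv` (p437125:
from the model hypotheses, two seed identifications `αs : Ψ(A_1) ⥲ A_1`, `βs : Ψ(B_1) ⥲ B_1` [Thm. 5.10 (i)], Prop. 5.3 (vi) at `A_1`
in `e = 1` form (`hdivcap₁`, `hdivcup₁`) and Prop. 2.4 (`hP24`, ∀γ-stability of `Π^tp_Ÿ`) ALONE: ONE base shadow `θ`, ONE unit
`e₁`, `D_c¹`, `D_p¹` with the five transport binders), then NORMALISED (`α₁ := αs ≪≫ e₁`, `β₁ := βs ≪≫ (D_c¹)⁻¹`, `u₁ := D_p¹`;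
`trans_left`) — so that, compared with the capstone of record `…_ofChosen_ofPulledConstants` (p435457), the binders `ef`, `Dcf`,
`he`, `θ₁`, `hstrv₁`, `hYdd₁` are GONE.  What remains: (A) `hnd`, `hN`, `hgc₁`, `hfac₁`, `hinj` as there; the seeds with
`hdivcap₁`/`hdivcup₁` and `hP24`; the coherent family `hfam` — for EVERY normalised anchor `(α₁, β₁, u₁)` and every `N`, identifications
`a, b` and a unit `w` with `a⁻¹ ≫ Ψ(s^⊓_N) ≫ b = s^⊓_N`, `a⁻¹ ≫ Ψ(s^⊔_N) ≫ b = s^⊔_N ≫ w`, `a⁻¹ ≫ Ψ(α_{1,N}) ≫ α₁ = α_{1,N}`,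
`b⁻¹ ≫ Ψ(β_{1,N}) ≫ β₁ = β_{1,N}` (the output of abc-iut-f-121's `NthRoot.exists_unit_transport_twisted`, p438241, for the level-`N`
root regarded as an `N`-th root of the `u₁`-twisted level-1 pair — Rmk. 4.3.2 / Prop. 4.2 (iv)); and (C) `hc` for every normalised
anchor (the level-1 discrepancy constant is a `2l`-th root of unity — Cor. 2.8 (i) on the classes of Prop. 5.2 (iii)).  The tower
is bound by the equation `hT` (instantiate with `rfl`).
[cite: MochizukiEtTh2009, Thm 5.7 p.329–330 (PDF pp.103–104); Thm 5.10 (ii) p.334 (PDF p.108); Rmk 4.3.2 p.318–319 (PDF pp.92–93); Lem 5.8 p.331 (PDF p.105)] -/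
theorem thetaRootPreservedAll_ofConnectedTemperoidYddFamily_ofConstAnchored_ofPulledConstants
    (T : ThetaFrobenioidTower.{w} (BiKummerSetting.mkOfConnectedTemperoidYddTower X tf hZ hP NH 𝒯 ιX).C
      (ConnectedPart (BTemp X.Pi)))
    (hT : T = ofConnectedTemperoidFamily h Q odd_l R ιX K' (fun N => (Units.map (tf.ratFnFunctor.map (t N).op).hom).comp c₀)
      hinj hinvc hinvp α β comm_sCap comm_sCup isIsometry_α degFr_α isIsometry_β degFr_β baseFrob_α)
    (hnd : IsNonDilatingOn tf.divisorMonoid)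
    (hN : ∃ A : (BiKummerSetting.mkOfConnectedTemperoidYddTower X tf hZ hP NH 𝒯 ιX).C,
      ¬ (PreFrobenioidData.ofModel tf.divisorMonoid tf.ratFnFunctor tf.divBNatTrans).IsGroupLikeObj A)
    (hgc₁ : ∀ u : (T.atLevel 1).units (T.BN 1),
      (∀ y ∈ (T.atLevel 1).imPiY, T.sgpCap 1 y * (u : Aut (T.BN 1)) * (T.sgpCap 1 y)⁻¹ = u) →
        (T.atLevel 1).unitsToBirat (T.BN 1) u ∈ (T.constEmb 1).range)
    (Ψ : (BiKummerSetting.mkOfConnectedTemperoidYddTower X tf hZ hP NH 𝒯 ιX).C ≌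
      (BiKummerSetting.mkOfConnectedTemperoidYddTower X tf hZ hP NH 𝒯 ιX).C)
    (hfac₁ : ∀ y ∈ (T.atLevel 1).imPiY, ∃ x ∈ (T.atLevel 1).HB, ∀ u ∈ (T.atLevel 1).units (T.BN 1),
      T.sgpCap 1 y * u * (T.sgpCap 1 y)⁻¹ = T.sgpCap 1 x * u * (T.sgpCap 1 x)⁻¹)
    -- the seeds of the anchor at the first root [Thm. 5.10 (i)] and the inputs of abc-iut-w5-d245's producer
    (αs : Ψ.functor.obj (T.AN 1) ≅ T.AN 1) (βs : Ψ.functor.obj (T.BN 1) ≅ T.BN 1)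
    (hdivcap₁ : T.pre.div (αs.inv ≫ Ψ.functor.map (T.sCap 1) ≫ βs.hom) = T.pre.div (T.sCap 1))
    (hdivcup₁ : T.pre.div (αs.inv ≫ Ψ.functor.map (T.sCup 1) ≫ βs.hom) = T.pre.div (T.sCup 1))
    (hP24 : ∀ γ : 𝒯.PiX ≃ₜ* 𝒯.PiX, 𝒯.PiYdd.map γ.toMulEquiv.toMonoidHom = 𝒯.PiYdd)
    -- the coherent family, for every normalised anchor WHOSE DISCREPANCY UNIT IS A GIVEN CONSTANT `c` (abc-iut-f-121's p438241 output shape)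
    (hfam : ∀ (α₁ : Ψ.functor.obj (T.AN 1) ≅ T.AN 1) (β₁ : Ψ.functor.obj (T.BN 1) ≅ T.BN 1) (u₁ : Aut (T.BN 1))
      (hu₁ : u₁ ∈ (T.atLevel 1).units (T.BN 1)),
      α₁.inv ≫ Ψ.functor.map (T.sCap 1) ≫ β₁.hom = T.sCap 1 →
      α₁.inv ≫ Ψ.functor.map (T.sCup 1) ≫ β₁.hom = T.sCup 1 ≫ u₁.hom →
      ∀ c : T.Kˣ, (T.atLevel 1).unitsToBirat (T.BN 1) ⟨u₁, hu₁⟩ = T.constEmb 1 c →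
        ∀ N : ℕ+, ∃ (a : Ψ.functor.obj (T.AN N) ≅ T.AN N) (b : Ψ.functor.obj (T.BN N) ≅ T.BN N) (w : Aut (T.BN N)),
          w ∈ (T.atLevel N).units (T.BN N) ∧
          a.inv ≫ Ψ.functor.map (T.sCap N) ≫ b.hom = T.sCap N ∧
          a.inv ≫ Ψ.functor.map (T.sCup N) ≫ b.hom = T.sCup N ≫ w.hom ∧
          a.inv ≫ Ψ.functor.map (T.α (one_dvd_level N)) ≫ α₁.hom = T.α (one_dvd_level N) ∧
          b.inv ≫ Ψ.functor.map (T.β (one_dvd_level N)) ≫ β₁.hom = T.β (one_dvd_level N))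
    -- (C): the level-1 discrepancy constant of every normalised transport is a `2l`-th root of unity
    (hc : ∀ (α₁ : Ψ.functor.obj (T.AN 1) ≅ T.AN 1) (β₁ : Ψ.functor.obj (T.BN 1) ≅ T.BN 1) (u₁ : Aut (T.BN 1))
      (hu₁ : u₁ ∈ (T.atLevel 1).units (T.BN 1)),
      α₁.inv ≫ Ψ.functor.map (T.sCap 1) ≫ β₁.hom = T.sCap 1 →
      α₁.inv ≫ Ψ.functor.map (T.sCup 1) ≫ β₁.hom = T.sCup 1 ≫ u₁.hom →
        ∀ c : T.Kˣ, (T.atLevel 1).unitsToBirat (T.BN 1) ⟨u₁, hu₁⟩ = T.constEmb 1 c → c ^ (2 * T.l) = 1) :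
    T.ThetaRootPreservedAll Ψ := by
  subst hT
  haveI := hX₀
  -- level-1 §5 facts (constants pulled back from `X₀`: Def. 3.6 (iii) is a theorem, abc-iut-w4-d008)
  have H₁ := ThetaFrobenioid.facts_ofConnectedTemperoidData (T := 𝒯.level ⟨1, 𝒯.one_mem⟩) h Q odd_l (R 1) ιX K'
    ((Units.map (tf.ratFnFunctor.map (t 1).op).hom).comp c₀) (hinj 1) (hinvc 1) (hinvp 1)
    (BiKummerSetting.hH_mkOfConnectedTemperoidYddTower X tf hZ hP NH 𝒯 ιX)
    (tf.biratAutModel_unitsMap_comp_apply_of_subsingleton (R 1).BN (t 1) c₀) hgc₁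
  -- the anchor PRODUCED at the first root (abc-iut-w5-d245, p437125)
  obtain ⟨θA, e₁, he₁, Dc₁, Dp₁, hTs, hTs', hDp₁, hstrvs, hYdds⟩ :=
    ThetaFrobenioid.exists_unit_transports_hYdd_ofConnectedTemperoidData_strv (T := 𝒯.level ⟨1, 𝒯.one_mem⟩) h Q odd_l
      (R 1) ιX K' ((Units.map (tf.ratFnFunctor.map (t 1).op).hom).comp c₀) (hinj 1) (hinvc 1) (hinvp 1)
      QuasiTemperoid.BTempConnected.connectedPart_isOfFSMType (SemiGraphs.TemperedArithmeticGroup.isSlim_connectedPart X)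
      hnd hN Ψ αs βs hdivcap₁ hdivcup₁ hP24
  -- normalisation: `α₁ := αs ≪≫ e₁`, `β₁ := βs ≪≫ (D_c¹)⁻¹`, `u₁ := D_p¹`
  have hnum : (αs ≪≫ e₁).inv ≫ Ψ.functor.map ((ofConnectedTemperoidFamily h Q odd_l R ιX K'
      (fun N => (Units.map (tf.ratFnFunctor.map (t N).op).hom).comp c₀) hinj hinvc hinvp α β comm_sCap comm_sCup
      isIsometry_α degFr_α isIsometry_β degFr_β baseFrob_α).sCap 1) ≫ (βs ≪≫ Dc₁.symm).hom =
      (ofConnectedTemperoidFamily h Q odd_l R ιX K' (fun N => (Units.map (tf.ratFnFunctor.map (t N).op).hom).comp c₀)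
        hinj hinvc hinvp α β comm_sCap comm_sCup isIsometry_α degFr_α isIsometry_β degFr_β baseFrob_α).sCap 1 := by
    -- abc-iut-w5-d245's conclusion read in the tower's currency (levels ARE `ofConnectedTemperoidData`, `rfl`)
    have hTs₂ : αs.inv ≫ Ψ.functor.map ((ofConnectedTemperoidFamily h Q odd_l R ιX K'
        (fun N => (Units.map (tf.ratFnFunctor.map (t N).op).hom).comp c₀) hinj hinvc hinvp α β comm_sCap comm_sCup
        isIsometry_α degFr_α isIsometry_β degFr_β baseFrob_α).sCap 1) ≫ (βs ≪≫ Dc₁.symm).hom =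
        e₁.hom ≫ (ofConnectedTemperoidFamily h Q odd_l R ιX K'
        (fun N => (Units.map (tf.ratFnFunctor.map (t N).op).hom).comp c₀) hinj hinvc hinvp α β comm_sCap comm_sCup
        isIsometry_α degFr_α isIsometry_β degFr_β baseFrob_α).sCap 1 ≫ (1 : Aut ((ofConnectedTemperoidFamily h Q odd_l R ιX K'
        (fun N => (Units.map (tf.ratFnFunctor.map (t N).op).hom).comp c₀) hinj hinvc hinvp α β comm_sCap comm_sCup
        isIsometry_α degFr_α isIsometry_β degFr_β baseFrob_α).BN 1)).hom := hTs
    rw [Iso.trans_inv, Category.assoc, hTs₂]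
    -- (`rw` cannot abstract the producer's witnesses at instances transparency; close by a term)
    exact (e₁.inv_hom_id_assoc _).trans (Category.comp_id _)
  have hden : (αs ≪≫ e₁).inv ≫ Ψ.functor.map ((ofConnectedTemperoidFamily h Q odd_l R ιX K'
      (fun N => (Units.map (tf.ratFnFunctor.map (t N).op).hom).comp c₀) hinj hinvc hinvp α β comm_sCap comm_sCup
      isIsometry_α degFr_α isIsometry_β degFr_β baseFrob_α).sCup 1) ≫ (βs ≪≫ Dc₁.symm).hom =
      (ofConnectedTemperoidFamily h Q odd_l R ιX K' (fun N => (Units.map (tf.ratFnFunctor.map (t N).op).hom).comp c₀)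
        hinj hinvc hinvp α β comm_sCap comm_sCup isIsometry_α degFr_α isIsometry_β degFr_β baseFrob_α).sCup 1 ≫
        Dp₁.hom := by
    have hTs₂' : αs.inv ≫ Ψ.functor.map ((ofConnectedTemperoidFamily h Q odd_l R ιX K'
        (fun N => (Units.map (tf.ratFnFunctor.map (t N).op).hom).comp c₀) hinj hinvc hinvp α β comm_sCap comm_sCup
        isIsometry_α degFr_α isIsometry_β degFr_β baseFrob_α).sCup 1) ≫ (βs ≪≫ Dc₁.symm).hom =
        e₁.hom ≫ (ofConnectedTemperoidFamily h Q odd_l R ιX K'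
        (fun N => (Units.map (tf.ratFnFunctor.map (t N).op).hom).comp c₀) hinj hinvc hinvp α β comm_sCap comm_sCup
        isIsometry_α degFr_α isIsometry_β degFr_β baseFrob_α).sCup 1 ≫ Dp₁.hom := hTs'
    rw [Iso.trans_inv, Category.assoc, hTs₂']
    exact e₁.inv_hom_id_assoc _
  -- `C` totally epimorphic and `Ψ^Aut(O^×(B_1)) = O^×(B_1)` for `β₁ := βs ≪≫ (D_c¹)⁻¹` (Thm. 4.4 (i); slimness of the base)
  have hepi : ∀ ⦃A' B' : (BiKummerSetting.mkOfConnectedTemperoidYddTower X tf hZ hP NH 𝒯 ιX).C⦄ (f : A' ⟶ B'), Epi f :=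
    ThetaFrobenioid.epi_of_model (DivB := tf.divBNatTrans) h
  obtain ⟨Ψbs, hΨbs, ⟨eΨ⟩⟩ := ThetaFrobenioid.exists_compatBase_of_model_slim
    (𝔉 := (ofConnectedTemperoidFamily h Q odd_l R ιX K' (fun N => (Units.map (tf.ratFnFunctor.map (t N).op).hom).comp c₀)
    hinj hinvc hinvp α β comm_sCap comm_sCup isIsometry_α degFr_α isIsometry_β degFr_β baseFrob_α).atLevel 1) Ψ rfl h
    QuasiTemperoid.BTempConnected.connectedPart_isOfFSMType (SemiGraphs.TemperedArithmeticGroup.isSlim_connectedPart X)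
    hnd hN
  haveI := hΨbs
  have hU₁ := ThetaFrobenioid.units_map_psiAut (𝔉 := (ofConnectedTemperoidFamily h Q odd_l R ιX K' (fun N => (Units.map (tf.ratFnFunctor.map (t N).op).hom).comp c₀)
    hinj hinvc hinvp α β comm_sCap comm_sCup isIsometry_α degFr_α isIsometry_β degFr_β baseFrob_α).atLevel 1) Ψ
    (βs ≪≫ Dc₁.symm) Ψbs eΨ
  -- the discrepancy unit `D_p¹` of the PRODUCED anchor is a constant `c ∈ K^×` (Lemma 5.8 / Thm. 5.7 rigidity at `N₁ = 1`)
  obtain ⟨c, hcst⟩ := exists_const_of_normalisedAnchor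
    (ofConnectedTemperoidFamily h Q odd_l R ιX K' (fun N => (Units.map (tf.ratFnFunctor.map (t N).op).hom).comp c₀)
      hinj hinvc hinvp α β comm_sCap comm_sCup isIsometry_α degFr_α isIsometry_β degFr_β baseFrob_α)
    Ψ hepi H₁.sgpCapSpec H₁.sgpCupSpec H₁.biKummerDifferenceMem H₁.constantsActByCyclotome hfac₁ hnum hden hDp₁ hU₁ _
    (ThetaFrobenioid.StrvTransport.trans_left _ hstrvs) hYdds
  -- the coherent family for this CONSTANT anchor
  choose a b w hw hTf hTf' hΨα hΨβ using hfam (αs ≪≫ e₁) (βs ≪≫ Dc₁.symm) Dp₁ hDp₁ hnum hden c hcst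
  refine thetaRootPreservedAll_of_anchoredFamily _ Ψ hepi ?_ H₁.sgpCapSpec H₁.sgpCupSpec H₁.biKummerDifferenceMem
    H₁.constantsActByCyclotome hfac₁ hnum hden hDp₁ hU₁ _ (ThetaFrobenioid.StrvTransport.trans_left _ hstrvs) hYdds
    (hc (αs ≪≫ e₁) (βs ≪≫ Dc₁.symm) Dp₁ hDp₁ hnum hden) a b w hw hTf hTf' hΨα hΨβ
  delta ofConnectedTemperoidFamily
  exact hconst_ofBiKummerFamily' h _ Q odd_l R ιX
      (fun N => BiKummerSetting.mkOfConnectedTemperoid_isOpen_ker_galoisSurj X tf hZ hP NH _ _ _ (R N).AN.base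
        (R N).αData.isGalois)
      _ K' (fun N => (Units.map (tf.ratFnFunctor.map (t N).op).hom).comp c₀) hinj
      (fun N => ThetaFrobenioid.hdivc_of_pull_invariant h.isDivisorial (R N) (ThetaFrobenioid.strvOfBiKummerData h (R N))
        (ThetaFrobenioid.baseMap_strvOfBiKummerData h (R N)) (hinvc N))
      (div_strv_comp_den_connFamily h R ιX hinvp)
      α β comm_sCap comm_sCup isIsometry_α degFr_α isIsometry_β degFr_β baseFrob_α
      (fun hd => rho_comm_β_of_natural R ιX
        (BiKummerSetting.mkOfConnectedTemperoid_galoisSurj_natural X tf hZ hP NH _ _ _) α β comm_sCap hd)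
      (fun N c => tf.ratFnFunctor_map_unitsMap_comp_of_subsingleton (t 1) (t N) (β (one_dvd_level N)) c₀ c)

end Genuine

end ThetaFrobenioidTower

end Literature.AnabelianGeometry.EtaleTheta

end
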